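import Mathlib
import Literature.NumberTheory.Automorphic.BLZPeriodCocycle
import HarnessLib

/-!
# `S_s^Γ = {0}` — discharge of `BruggemanLewisZagier2015_singularities_invariants`

Topic `NumberTheory/Automorphic`; sibling proof file of `BLZPeriodCocycle`, discharging its named
fact `BruggemanLewisZagier2015_singularities_invariants` (Bruggeman–Lewis–Zagier, *Period functions
for Maass wave forms and cohomology*, Mem. AMS 237 no. 1118 (2015), §13.1, p. 83 of the held
authors' version: "Since all `Γ`-orbits in `∂ℍ` are infinite, we have
`(W/V_s^ω)^Γ ⊂ S_s^Γ = {0}`") as `BruggemanLewisZagier2015_singularities_invariants_holds`.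

## The printed argument and how it is mirrored

For `f ∈ V_s^{ω*}` the set of singularities `BdSing f ⊂ P¹(ℝ)` (p. 16: the minimal finite set
off which `f` is a section of `V_s^ω`) is finite, `BdSing (f | g) = g⁻¹ BdSing f` (p. 82:
"`f ↦ f | g` induces an isomorphism `S_{s,ξ} → S_{s,g⁻¹ξ}`"), and `BdSing` does not see
`V_s^ω`. So if every `f|γ - f` (`γ ∈ Γ`) is in `V_s^ω`, `BdSing f` is a finite `Γ`-invariant
subset of `P¹(ℝ)`; all `Γ`-orbits being infinite, it is empty, i.e. `f ∈ V_s^ω` (p. 83).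

In the line model of `BLZPeriodCocycle` (total functions `ℝ → ℂ`, identities off finite sets) we
use, instead of `BdSing`, its complement, the **regular points**: `t₀ ∈ ℝ` is regular for `φ` when
`φ` agrees on a punctured neighbourhood of `t₀` with a function real-analytic at `t₀`
(written out as `∃ G, AnalyticAt ℝ G t₀ ∧ ∀ᶠ t in 𝓝[≠] t₀, φ t = G t`; no new definition is
introduced), and `∞` is regular when `0` is regular for the flip `u ↦ |u|^{-2s} φ(-1/u)` (the
slash by `S = (0 -1; 1 0)`, matching the condition at `∞` in `IsAnalyticVector`).

1. Regularity is local (invariant under modification off a finite set, `nhdsNE_le_cofinite`),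
   stable under subtracting an analytic vector, and every point off the finite exceptional set of
   a semi-analytic vector is regular (`lineRegular_*`).
2. **Transport** (the finite part of `BdSing (f|g) = g⁻¹ BdSing f`, one inclusion): if `g t₀`
   is regular for `φ` and `t₀` is not the pole of `g`, then `t₀` is regular for `φ | g`
   (`lineRegular_lineSlash`: the Möbius map sends `𝓝[≠] t₀` into `𝓝[≠] (g t₀)` by injectivity,
   and `analyticAt_lineSlash` of `BLZPeriodCocycle`); and if `g ∞ = a/c` (`c ≠ 0`) is regular for
   `φ` then `∞` is regular for `φ | g` (`lineRegular_flip_lineSlash`, via `(φ|g)|S = φ|(gS)` off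
   `0`, `lineSlash_mul`).
3. **Orbit argument** (p. 83): by the hypothesis `φ|γ - φ ≡ ψ_γ ∈ V_s^ω`, regularity of a point
   for `φ|γ` implies its regularity for `φ`. If `t₀ ∈ ℝ` were singular, every finite point
   `γ t₀` of its (infinite) `Γ`-orbit would be singular, contradicting finiteness; then `∞` is
   regular too, using one `γ ∈ Γ` with `γ ∞ ≠ ∞` (which exists since the orbit of `∞` is
   infinite).
4. **Gluing**: `φ' t := lim_{x → t, x ≠ t} φ x` is real-analytic on `ℝ` (near each `t₀` it is the
   local analytic representative, by uniqueness of limits along `𝓝[≠] t`), agrees with `φ` off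
   the exceptional finite set, and inherits the condition at `∞`.

Only Mathlib and `BLZPeriodCocycle` are used; the determinant-one and `0 < Re s < 1` hypotheses
of the fact are not needed for this set-theoretic step (as in the source, where only the
finiteness of `BdSing` and the infinitude of the orbits enter).

## References

* [BruggemanLewisZagier2015] R. Bruggeman, J. Lewis, D. Zagier, *Period functions for Maass wave
  forms and cohomology*, Mem. Amer. Math. Soc. 237 (2015), no. 1118, doi:10.1090/memo/1118:
  `BdSing` p. 16 (after (2.23)); §13.1 "Space of singularities", `S_{s,ξ} | g = S_{s,g⁻¹ξ}`
  p. 82; (13.2) and "`(W/V_s^ω)^Γ ⊂ S_s^Γ = {0}`" p. 83.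
-/

noncomputable section

namespace Literature.NumberTheory.Automorphic

open _root_.Filter _root_.Set
open scoped MatrixGroups Topology

section SingularitiesProofs

/-! ## 1. Regular points in the line model -/

/-- A function analytic at `t₀` is regular at `t₀` (it is its own local representative).
[folklore] -/
theorem lineRegular_of_analyticAt {φ : ℝ → ℂ} {t₀ : ℝ} (h : AnalyticAt ℝ φ t₀) :
    ∃ G : ℝ → ℂ, AnalyticAt ℝ G t₀ ∧ ∀ᶠ t in 𝓝[≠] t₀, φ t = G t :=
  ⟨φ, h, Eventually.of_forall fun _ => rfl⟩

/-- Regularity at `t₀` only depends on the germ of the function on a punctured neighbourhood of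
`t₀`. [folklore] -/
theorem lineRegular_congr {φ φ' : ℝ → ℂ} {t₀ : ℝ} (he : ∀ᶠ t in 𝓝[≠] t₀, φ t = φ' t)
    (h : ∃ G : ℝ → ℂ, AnalyticAt ℝ G t₀ ∧ ∀ᶠ t in 𝓝[≠] t₀, φ t = G t) :
    ∃ G : ℝ → ℂ, AnalyticAt ℝ G t₀ ∧ ∀ᶠ t in 𝓝[≠] t₀, φ' t = G t := by
  obtain ⟨G, hG, hφG⟩ := h
  exact ⟨G, hG, by filter_upwards [he, hφG] with t h1 h2; rw [← h1, h2]⟩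

/-- Regular points are stable under subtraction. [folklore] -/
theorem lineRegular_sub {φ ψ : ℝ → ℂ} {t₀ : ℝ}
    (hφ : ∃ G : ℝ → ℂ, AnalyticAt ℝ G t₀ ∧ ∀ᶠ t in 𝓝[≠] t₀, φ t = G t)
    (hψ : ∃ G : ℝ → ℂ, AnalyticAt ℝ G t₀ ∧ ∀ᶠ t in 𝓝[≠] t₀, ψ t = G t) :
    ∃ G : ℝ → ℂ, AnalyticAt ℝ G t₀ ∧ ∀ᶠ t in 𝓝[≠] t₀, φ t - ψ t = G t := by
  obtain ⟨G, hG, hφG⟩ := hφ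
  obtain ⟨K, hK, hψK⟩ := hψ
  exact ⟨fun t => G t - K t, hG.sub hK, by filter_upwards [hφG, hψK] with t h1 h2; rw [h1, h2]⟩

/-- The Möbius map of `g ∈ GL₂(ℝ)` is injective off its pole. [folklore] -/
theorem moebius_injective_off_pole (g : GL (Fin 2) ℝ) {t₁ t₂ : ℝ}
    (h₁ : g 1 0 * t₁ + g 1 1 ≠ 0) (h₂ : g 1 0 * t₂ + g 1 1 ≠ 0)
    (h : (g 0 0 * t₁ + g 0 1) / (g 1 0 * t₁ + g 1 1) =
      (g 0 0 * t₂ + g 0 1) / (g 1 0 * t₂ + g 1 1)) :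
    t₁ = t₂ := by
  have hdet : (g 0 0 : ℝ) * g 1 1 - g 0 1 * g 1 0 ≠ 0 := by
    have h1 : ((g : GL (Fin 2) ℝ) : Matrix (Fin 2) (Fin 2) ℝ).det ≠ 0 :=
      Matrix.GeneralLinearGroup.det_ne_zero g
    rw [Matrix.det_fin_two] at h1
    exact h1
  rw [div_eq_div_iff h₁ h₂] at h
  have e2 : ((g 0 0 : ℝ) * g 1 1 - g 0 1 * g 1 0) * (t₁ - t₂) = 0 := by linear_combination h
  rcases mul_eq_zero.mp e2 with h0 | h0
  · exact absurd h0 hdet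
  · linarith

/-- **Transport of regularity under the slash action, finite part** (one inclusion of
`BdSing (f | g) = g⁻¹ BdSing f`, p. 82): if `t₀` is not the pole of `g` and `g t₀` is a regular
point of `φ`, then `t₀` is a regular point of `φ |_{2s} g`.
[cite: BruggemanLewisZagier2015, §13.1 p. 82] -/
theorem lineRegular_lineSlash (s : ℂ) (g : GL (Fin 2) ℝ) {φ : ℝ → ℂ} {t₀ : ℝ}
    (ht₀ : g 1 0 * t₀ + g 1 1 ≠ 0)
    (h : ∃ F : ℝ → ℂ, AnalyticAt ℝ F ((g 0 0 * t₀ + g 0 1) / (g 1 0 * t₀ + g 1 1)) ∧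
      ∀ᶠ x in 𝓝[≠] ((g 0 0 * t₀ + g 0 1) / (g 1 0 * t₀ + g 1 1)), φ x = F x) :
    ∃ G : ℝ → ℂ, AnalyticAt ℝ G t₀ ∧ ∀ᶠ t in 𝓝[≠] t₀, lineSlash s g φ t = G t := by
  obtain ⟨F, hF, hφF⟩ := h
  refine ⟨lineSlash s g F, analyticAt_lineSlash s g ht₀ hF, ?_⟩
  -- the Möbius map of `g` sends `𝓝[≠] t₀` into `𝓝[≠] (g t₀)`
  have hden : ∀ᶠ t in 𝓝 t₀, g 1 0 * t + g 1 1 ≠ 0 := by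
    have hc : Continuous fun t : ℝ => (g 1 0 : ℝ) * t + g 1 1 := by fun_prop
    exact hc.continuousAt.eventually_ne ht₀
  have htend : Tendsto (fun x : ℝ => (g 0 0 * x + g 0 1) / (g 1 0 * x + g 1 1)) (𝓝[≠] t₀)
      (𝓝[≠] ((g 0 0 * t₀ + g 0 1) / (g 1 0 * t₀ + g 1 1))) := by
    refine tendsto_nhdsWithin_iff.2 ⟨?_, ?_⟩
    · exact (analyticAt_moebius g ht₀).continuousAt.tendsto.mono_left nhdsWithin_le_nhds
    · rw [eventually_nhdsWithin_iff]
      filter_upwards [hden] with t hd hne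
      intro hEq
      exact hne (moebius_injective_off_pole g hd ht₀ hEq)
  filter_upwards [htend.eventually hφF] with t ht
  have ht' : φ ((g 0 0 * t + g 0 1) / (g 1 0 * t + g 1 1)) =
      F ((g 0 0 * t + g 0 1) / (g 1 0 * t + g 1 1)) := ht
  rw [lineSlash_apply, lineSlash_apply, ht']

/-! ## 2. The flip `S = (0 -1; 1 0)` and the point at infinity -/

/-- The matrix `S = (0 -1; 1 0) ∈ GL₂(ℝ)` (whose slash is the chart at `∞` of the line model,
`(φ | S)(t) = |t|^{-2s} φ(-1/t)`). [cite: BruggemanLewisZagier2015, (2.2) p. 12] -/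
theorem exists_flip_gl :
    ∃ S : GL (Fin 2) ℝ, (S 0 0 : ℝ) = 0 ∧ (S 0 1 : ℝ) = -1 ∧ (S 1 0 : ℝ) = 1 ∧ (S 1 1 : ℝ) = 0 := by
  refine ⟨Matrix.GeneralLinearGroup.mkOfDetNeZero !![(0 : ℝ), -1; 1, 0]
    (by norm_num [Matrix.det_fin_two_of]), ?_, ?_, ?_, ?_⟩ <;> rfl

/-- `(φ |_{2s} S)(t) = |t|^{-2s} φ(-1/t)` for `S = (0 -1; 1 0)`: the slash by `S` is the
expression whose analyticity at `0` is the condition at `∞` in `IsAnalyticVector`.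
[cite: BruggemanLewisZagier2015, (2.2) p. 12] -/
theorem lineSlash_flip_apply (s : ℂ) {S : GL (Fin 2) ℝ} (h00 : (S 0 0 : ℝ) = 0)
    (h01 : (S 0 1 : ℝ) = -1) (h10 : (S 1 0 : ℝ) = 1) (h11 : (S 1 1 : ℝ) = 0) (φ : ℝ → ℂ)
    (t : ℝ) : lineSlash s S φ t = ((|t| : ℝ) : ℂ) ^ (-(2 * s)) * φ (-1 / t) := by
  rw [lineSlash_apply, h00, h01, h10, h11]
  simp

/-- **Transport of regularity, the point at infinity**: if `c ≠ 0` and `g ∞ = a/c` is a regular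
point of `φ`, then `∞` is a regular point of `φ |_{2s} g`, i.e. `0` is a regular point of
`u ↦ |u|^{-2s} (φ | g)(-1/u)` (because `(φ | g) | S = φ | (g S)` off `u = 0` and `0` is not the
pole of `g S`). [cite: BruggemanLewisZagier2015, §13.1 p. 82] -/
theorem lineRegular_flip_lineSlash (s : ℂ) (g : GL (Fin 2) ℝ) {φ : ℝ → ℂ} (hc : (g 1 0 : ℝ) ≠ 0)
    (h : ∃ F : ℝ → ℂ, AnalyticAt ℝ F (g 0 0 / g 1 0 : ℝ) ∧
      ∀ᶠ x in 𝓝[≠] (g 0 0 / g 1 0 : ℝ), φ x = F x) :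
    ∃ G : ℝ → ℂ, AnalyticAt ℝ G 0 ∧
      ∀ᶠ u in 𝓝[≠] (0 : ℝ), ((|u| : ℝ) : ℂ) ^ (-(2 * s)) * lineSlash s g φ (-1 / u) = G u := by
  obtain ⟨S, h00, h01, h10, h11⟩ := exists_flip_gl
  -- the relevant entries of `g * S = (b, -a; d, -c)`
  have e01 : ((g * S : GL (Fin 2) ℝ) 0 1 : ℝ) = -g 0 0 := by rw [gl_mul_apply, h01, h11]; ring
  have e11 : ((g * S : GL (Fin 2) ℝ) 1 1 : ℝ) = -g 1 0 := by rw [gl_mul_apply, h01, h11]; ring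
  -- `0` is not a pole of `g * S`, which maps it to `a / c`
  have hpole : ((g * S : GL (Fin 2) ℝ) 1 0 : ℝ) * (0 : ℝ) + ((g * S : GL (Fin 2) ℝ) 1 1 : ℝ) ≠ 0 := by
    rw [e11]; simpa using hc
  have hpt : (((g * S : GL (Fin 2) ℝ) 0 0 : ℝ) * (0 : ℝ) + ((g * S : GL (Fin 2) ℝ) 0 1 : ℝ)) /
      (((g * S : GL (Fin 2) ℝ) 1 0 : ℝ) * (0 : ℝ) + ((g * S : GL (Fin 2) ℝ) 1 1 : ℝ)) =
        g 0 0 / g 1 0 := by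
    rw [e01, e11]; simp only [mul_zero, zero_add, neg_div_neg_eq]
  have h' := lineRegular_lineSlash s (g * S) (φ := φ) (t₀ := 0) hpole (by rw [hpt]; exact h)
  -- `(φ | g) | S = φ | (g S)` off `u = 0`
  refine lineRegular_congr ?_ h'
  filter_upwards [self_mem_nhdsWithin] with u hu
  have hu' : u ≠ 0 := hu
  have hSu : S 1 0 * u + S 1 1 ≠ 0 := by rw [h10, h11]; simpa using hu'
  rw [lineSlash_mul s g S φ hSu, lineSlash_flip_apply s h00 h01 h10 h11]

/-- An analytic vector is regular at `∞`. [cite: BruggemanLewisZagier2015, (2.2) p. 12] -/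
theorem IsAnalyticVector.lineRegular_flip {s : ℂ} {ψ : ℝ → ℂ} (h : IsAnalyticVector s ψ) :
    ∃ G : ℝ → ℂ, AnalyticAt ℝ G 0 ∧
      ∀ᶠ u in 𝓝[≠] (0 : ℝ), ((|u| : ℝ) : ℂ) ^ (-(2 * s)) * ψ (-1 / u) = G u := by
  obtain ⟨G, hG, hGeq⟩ := h.2
  refine ⟨G, hG, ?_⟩
  filter_upwards [self_mem_nhdsWithin] with u hu
  have hu' : u ≠ 0 := hu
  exact (hGeq u hu').symm

/-- Regularity at `∞` only depends on the function off a finite set. [folklore] -/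
theorem lineRegular_flip_congr_cofinite (s : ℂ) {φ φ' : ℝ → ℂ}
    (he : ∀ᶠ t in cofinite, φ t = φ' t)
    (h : ∃ G : ℝ → ℂ, AnalyticAt ℝ G 0 ∧
      ∀ᶠ u in 𝓝[≠] (0 : ℝ), ((|u| : ℝ) : ℂ) ^ (-(2 * s)) * φ (-1 / u) = G u) :
    ∃ G : ℝ → ℂ, AnalyticAt ℝ G 0 ∧
      ∀ᶠ u in 𝓝[≠] (0 : ℝ), ((|u| : ℝ) : ℂ) ^ (-(2 * s)) * φ' (-1 / u) = G u := by
  obtain ⟨S, h00, h01, h10, h11⟩ := exists_flip_gl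
  have h1 := lineSlash_congr_cofinite s S he
  have h2 : ∀ᶠ u in 𝓝[≠] (0 : ℝ), ((|u| : ℝ) : ℂ) ^ (-(2 * s)) * φ (-1 / u) =
      ((|u| : ℝ) : ℂ) ^ (-(2 * s)) * φ' (-1 / u) := by
    filter_upwards [h1.filter_mono (nhdsNE_le_cofinite 0)] with u hu
    rwa [lineSlash_flip_apply s h00 h01 h10 h11, lineSlash_flip_apply s h00 h01 h10 h11] at hu
  exact lineRegular_congr h2 h

/-- Regularity at `∞` is stable under subtracting an analytic vector.
[cite: BruggemanLewisZagier2015, §13.1 p. 82] -/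
theorem lineRegular_flip_sub (s : ℂ) {φ ψ : ℝ → ℂ}
    (hφ : ∃ G : ℝ → ℂ, AnalyticAt ℝ G 0 ∧
      ∀ᶠ u in 𝓝[≠] (0 : ℝ), ((|u| : ℝ) : ℂ) ^ (-(2 * s)) * φ (-1 / u) = G u)
    (hψ : IsAnalyticVector s ψ) :
    ∃ G : ℝ → ℂ, AnalyticAt ℝ G 0 ∧
      ∀ᶠ u in 𝓝[≠] (0 : ℝ),
        ((|u| : ℝ) : ℂ) ^ (-(2 * s)) * (φ (-1 / u) - ψ (-1 / u)) = G u := by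
  have h1 := lineRegular_sub hφ hψ.lineRegular_flip
  refine lineRegular_congr ?_ h1
  exact Eventually.of_forall fun u => (mul_sub _ _ _).symm

/-! ## 3. Gluing the local representatives -/

/-- If `φ` agrees with the analytic `h` on a punctured neighbourhood of `t₀`, then near `t₀` the
punctured limit `t ↦ lim_{x → t, x ≠ t} φ x` is `h` (uniqueness of limits; `𝓝[≠] t` is non-trivial
on `ℝ`). [folklore] -/
theorem limUnder_nhdsNE_eventuallyEq {φ h : ℝ → ℂ} {t₀ : ℝ} (hh : AnalyticAt ℝ h t₀)
    (he : ∀ᶠ t in 𝓝[≠] t₀, φ t = h t) :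
    ∀ᶠ t in 𝓝 t₀, limUnder (𝓝[≠] t) φ = h t := by
  have h1 : ∀ᶠ t in 𝓝 t₀, AnalyticAt ℝ h t := hh.eventually_analyticAt
  have h2 : ∀ᶠ t in 𝓝 t₀, ∀ᶠ x in 𝓝 t, x ∈ ({t₀}ᶜ : Set ℝ) → φ x = h x :=
    (eventually_nhdsWithin_iff.mp he).eventually_nhds
  filter_upwards [h1, h2] with t ht1 ht2
  have h3 : ∀ᶠ x in 𝓝[≠] t, φ x = h x := by
    by_cases htt : t = t₀
    · subst htt
      exact he
    · have h4 : ∀ᶠ x in 𝓝 t, x ≠ t₀ := isOpen_ne.eventually_mem htt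
      exact ((h4.and ht2).mono fun x hx => hx.2 hx.1).filter_mono nhdsWithin_le_nhds
  have h5 : Tendsto φ (𝓝[≠] t) (𝓝 (h t)) :=
    (ht1.continuousAt.tendsto.mono_left nhdsWithin_le_nhds).congr'
      (Filter.EventuallyEq.symm h3)
  exact h5.limUnder_eq

/-! ## 4. The theorem -/

/-- **Bruggeman–Lewis–Zagier, §13.1 p. 83: `S_s^Γ = {0}`** (discharge of
`BruggemanLewisZagier2015_singularities_invariants`). If all `Γ`-orbits in `P¹(ℝ)` are infinite,
a semi-analytic vector `φ` all of whose coboundary values `φ|γ - φ` (`γ ∈ Γ`) are analytic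
vectors off finite sets agrees off a finite set with an analytic vector: its finite set of
singular points in `P¹(ℝ)` is `Γ`-invariant ("`S_{s,ξ} | g = S_{s,g⁻¹ξ}`", p. 82), hence empty
("Since all `Γ`-orbits in `∂ℍ` are infinite, we have `(W/V_s^ω)^Γ ⊂ S_s^Γ = {0}`", p. 83), and
the local analytic representatives glue. [cite: BruggemanLewisZagier2015, §13.1 (13.2) p. 83] -/
theorem BruggemanLewisZagier2015_singularities_invariants_holds :
    BruggemanLewisZagier2015_singularities_invariants := by
  intro Γ _ horb s _ _ φ hφ hcob
  classical
  -- (1) `φ ≡ φ|γ - ψ_γ`: regularity of a point for `φ|γ` gives regularity for `φ`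
  have hfinTrans : ∀ γ ∈ Γ, ∀ t₀ : ℝ,
      (∃ G : ℝ → ℂ, AnalyticAt ℝ G t₀ ∧ ∀ᶠ t in 𝓝[≠] t₀, lineSlash s γ φ t = G t) →
      ∃ G : ℝ → ℂ, AnalyticAt ℝ G t₀ ∧ ∀ᶠ t in 𝓝[≠] t₀, φ t = G t := by
    intro γ hγ t₀ hreg
    obtain ⟨ψ, hψ, hcobγ⟩ := hcob γ hγ
    have h1 := lineRegular_sub hreg (lineRegular_of_analyticAt (hψ.1 t₀ (mem_univ _)))
    refine lineRegular_congr ?_ h1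
    filter_upwards [hcobγ.filter_mono (nhdsNE_le_cofinite t₀)] with t ht
    rw [← ht]
    ring
  have hinfTrans : ∀ γ ∈ Γ,
      (∃ G : ℝ → ℂ, AnalyticAt ℝ G 0 ∧ ∀ᶠ u in 𝓝[≠] (0 : ℝ),
        ((|u| : ℝ) : ℂ) ^ (-(2 * s)) * lineSlash s γ φ (-1 / u) = G u) →
      ∃ G : ℝ → ℂ, AnalyticAt ℝ G 0 ∧ ∀ᶠ u in 𝓝[≠] (0 : ℝ),
        ((|u| : ℝ) : ℂ) ^ (-(2 * s)) * φ (-1 / u) = G u := by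
    intro γ hγ hreg
    obtain ⟨ψ, hψ, hcobγ⟩ := hcob γ hγ
    have h1 := lineRegular_flip_sub s hreg hψ
    refine lineRegular_flip_congr_cofinite s (φ := fun t => lineSlash s γ φ t - ψ t) (φ' := φ)
      ?_ h1
    filter_upwards [hcobγ] with t ht
    rw [← ht]
    ring
  -- (2) every point of `ℝ` is regular for `φ` (orbit argument, p. 83)
  have hreg : ∀ t₀ : ℝ, ∃ G : ℝ → ℂ, AnalyticAt ℝ G t₀ ∧ ∀ᶠ t in 𝓝[≠] t₀, φ t = G t := by
    obtain ⟨F, hF⟩ := hφ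
    set Sing : Set ℝ :=
      {t | ¬ ∃ G : ℝ → ℂ, AnalyticAt ℝ G t ∧ ∀ᶠ x in 𝓝[≠] t, φ x = G x} with hSing
    have hSfin : Sing.Finite := by
      refine F.finite_toSet.subset fun t ht => ?_
      by_contra htF
      exact ht (lineRegular_of_analyticAt (hF t htF))
    intro t₀
    by_contra ht₀
    -- the `Γ`-orbit of `t₀`, minus `∞`, consists of singular points
    have hsub : {y : OnePoint ℝ | ∃ γ ∈ Γ, γ • ((t₀ : ℝ) : OnePoint ℝ) = y} ⊆
        ((fun t : ℝ => (t : OnePoint ℝ)) '' Sing) ∪ {OnePoint.infty} := by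
      rintro y ⟨γ, hγ, rfl⟩
      by_cases hpole : (γ 1 0 : ℝ) * t₀ + γ 1 1 = 0
      · right
        simp [OnePoint.smul_some_eq_ite, hpole]
      · left
        refine ⟨(γ 0 0 * t₀ + γ 0 1) / (γ 1 0 * t₀ + γ 1 1), ?_, ?_⟩
        · intro hM
          exact ht₀ (hfinTrans γ hγ t₀ (lineRegular_lineSlash s γ hpole hM))
        · simp [OnePoint.smul_some_eq_ite, hpole]
    exact horb _ (((hSfin.image _).union (finite_singleton _)).subset hsub)
  -- (3) `∞` is regular for `φ`: move it to a finite point by some `γ ∈ Γ` with `γ ∞ ≠ ∞`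
  have hreginf : ∃ G : ℝ → ℂ, AnalyticAt ℝ G 0 ∧ ∀ᶠ u in 𝓝[≠] (0 : ℝ),
      ((|u| : ℝ) : ℂ) ^ (-(2 * s)) * φ (-1 / u) = G u := by
    obtain ⟨γ, hγ, hc⟩ : ∃ γ ∈ Γ, (γ 1 0 : ℝ) ≠ 0 := by
      by_contra hcon
      push Not at hcon
      refine horb OnePoint.infty ((finite_singleton (OnePoint.infty : OnePoint ℝ)).subset ?_)
      rintro y ⟨γ, hγ, rfl⟩
      simp [OnePoint.smul_infty_eq_ite, hcon γ hγ]
    exact hinfTrans γ hγ (lineRegular_flip_lineSlash s γ hc (hreg _))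
  -- (4) glue: `φ' t = lim_{x → t, x ≠ t} φ x`
  have hcof : ∀ᶠ t in cofinite, φ t = limUnder (𝓝[≠] t) φ := by
    obtain ⟨F, hF⟩ := hφ
    refine Filter.eventually_cofinite.mpr (F.finite_toSet.subset fun t ht => ?_)
    by_contra htF
    exact ht ((limUnder_nhdsNE_eventuallyEq (hF t htF)
      (Eventually.of_forall fun _ => rfl)).self_of_nhds).symm
  obtain ⟨K, hK, hφK⟩ := hreginf
  refine ⟨fun t => limUnder (𝓝[≠] t) φ, ⟨fun t₀ _ => ?_, ?_⟩, hcof⟩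
  · -- real-analytic at `t₀`
    obtain ⟨G, hG, hφG⟩ := hreg t₀
    exact hG.congr (Filter.EventuallyEq.symm (limUnder_nhdsNE_eventuallyEq hG hφG))
  · -- the condition at `∞`
    refine ⟨fun u => if u = 0 then K 0 else
      ((|u| : ℝ) : ℂ) ^ (-(2 * s)) * limUnder (𝓝[≠] (-1 / u)) φ, ?_, fun t ht => by simp [ht]⟩
    refine hK.congr (eventuallyEq_nhds_of_eventuallyEq_nhdsNE ?_ (by simp))
    obtain ⟨S, h00, h01, h10, h11⟩ := exists_flip_gl
    have h2 : ∀ᶠ u in 𝓝[≠] (0 : ℝ), ((|u| : ℝ) : ℂ) ^ (-(2 * s)) * φ (-1 / u) =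
        ((|u| : ℝ) : ℂ) ^ (-(2 * s)) * limUnder (𝓝[≠] (-1 / u)) φ := by
      filter_upwards [(lineSlash_congr_cofinite s S hcof).filter_mono (nhdsNE_le_cofinite 0)]
        with u hu
      rwa [lineSlash_flip_apply s h00 h01 h10 h11, lineSlash_flip_apply s h00 h01 h10 h11] at hu
    filter_upwards [hφK, h2, self_mem_nhdsWithin] with u hKu h2u hu
    have hu' : u ≠ 0 := hu
    show K u = if u = 0 then K 0 else ((|u| : ℝ) : ℂ) ^ (-(2 * s)) * limUnder (𝓝[≠] (-1 / u)) φ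
    rw [if_neg hu', ← h2u, hKu]

end SingularitiesProofs

end Literature.NumberTheory.Automorphic
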